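import Mathlib
import HarnessLib
import Summits.NavierStokesRegularity.NavierStokesRegularity.Theorems.TaylorModelRungThreeCertificateIntervalDMatrix

/-!
# Crux K1b-DR (stmt-NavierStokesRegularity-23954), line `taylor-model` — certificate SOUNDNESS tooling: the INTERVAL
# LINEAR-ALGEBRA KERNEL of the v3 checker, part 2 — MAGNITUDES, UPWARD PRODUCTS, TESTS, `ciBox`
# (CERT-CONTRACT-23954 v3.1 §3 C3; PROPAGATE-V-SPEC-cert1 §2 D/F; director rulings dss_56/58/60)

Continuation of `…CertificateIntervalDMatrix`. The cross-step clauses of the frame-absorbed vector step are componentwise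
inequalities between NONNEGATIVE dyadic vectors (`|T_s|·rP^l_s + |CiBox_{s+1}|·ν^l ≤ rP^l_{s+1}`, PROPAGATE-V-SPEC §2 F) and
one row-sum test per frame (`‖I − X·Cm‖_∞ ≤ θ`, §2 D). This file supplies, array-coded with structural loops:

* `magM` (entrywise `mag` of an interval matrix, `absLeMat_magM`), `absD` (entrywise `|·|` of a point matrix);
* `dotUp` / `absMulVecUp` — `Σ_t A r t · R t` rounded UP after every operation, with `abs_sum_le_absMulVecUp`:
  `|a| ≤ A`, `|ξ| ≤ R` entrywise ⇒ `|Σ_t a r t · ξ t| ≤ (|A|·R)_r`; `addVecUp`; the componentwise test `leVec` (`le_of_leVec`);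
* `rowMagUp` / `checkRowSumLe` — upward row sums of magnitudes and the test `‖e‖_∞ ≤ θ` for every real `e ∈ M`
  (`rowSum_le_of_checkRowSumLe`);
* `colMaxAbs` / `ciBox X φ = X ⊕ [−φ·m_c, φ·m_c]`, `m_c = max_r |X r c|` — the shape of the Neumann enclosure of an inverse
  near `X` (`memMat_ciBox`; the inverse itself is produced in `…CertificateFrameNeumann`);
* the generic structural quantifier `allBelow` (`allBelow_eq_true`).

References: R. E. Moore, *Interval Analysis* (1966) Ch. 4; A. Neumaier, *Interval Methods for Systems of Equations* (1990)
§3.1–3.2. [folklore]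
MODEL-lattice bookkeeping only (rung TL-M3, one finite-dimensional model ODE); nothing here concerns the Navier–Stokes equations.
-/

-- the sub-problem namespace repeats the summit name by design (D-0017)
set_option linter.dupNamespace false

namespace Summit.NavierStokesRegularity.NavierStokesRegularity.Theorems.TaylorModelCert

open scoped BigOperators

section Bounds

/-- Entrywise magnitude of an interval matrix. [folklore] -/
def magM (n : ℕ) (M : Array (Array IntervalD)) : Array (Array Dyad) :=
  Array.ofFn (n := n) fun r =>
    let Mr := rowOf M r
    Array.ofFn (n := n) fun c => IntervalD.mag (IntervalD.aget Mr c)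

/-- Entrywise absolute value of a dyadic matrix. [folklore] -/
def absD (n : ℕ) (A : Array (Array Dyad)) : Array (Array Dyad) :=
  Array.ofFn (n := n) fun r =>
    let Ar := rowOf A r
    Array.ofFn (n := n) fun c => Dyad.abs (dget Ar c)

/-- `Σ_{t<k} Ar[t]·R[t]`, rounded UP after every operation. [folklore] -/
def dotUp (prec : ℕ) (Ar R : Array Dyad) : ℕ → Dyad
  | 0 => Dyad.zero
  | t + 1 => Dyad.addUp prec (dotUp prec Ar R t) (Dyad.mulUp prec (dget Ar t) (dget R t))

/-- Upper bound of `A·R` for an entrywise-nonnegative dyadic matrix `A` and vector `R` (`|T_s|·rP`, `|CiBox|·ν`). [folklore] -/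
def absMulVecUp (n prec : ℕ) (A : Array (Array Dyad)) (R : Array Dyad) : Array Dyad :=
  Array.ofFn (n := n) fun r => dotUp prec (rowOf A r) R n

/-- Upward-rounded componentwise sum of two dyadic vectors. [folklore] -/
def addVecUp (n prec : ℕ) (u v : Array Dyad) : Array Dyad :=
  Array.ofFn (n := n) fun c => Dyad.addUp prec (dget u c) (dget v c)

/-- Structural `∀ c < k, p c`. [folklore] -/
def allBelow (p : ℕ → Bool) : ℕ → Bool
  | 0 => true
  | k + 1 => allBelow p k && p k

/-- TEST `u ≤ v` componentwise below `n`. [folklore] -/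
def leVec (n : ℕ) (u v : Array Dyad) : Bool := allBelow (fun c => Dyad.ble (dget u c) (dget v c)) n

/-- TEST `0 ≤ v` componentwise below `n`. [folklore] -/
def nonnegVec (n : ℕ) (v : Array Dyad) : Bool := allBelow (fun c => Dyad.ble Dyad.zero (dget v c)) n

/-- `Σ_{c<k} mag Mr[c]`, rounded UP (row sum of magnitudes). [folklore] -/
def rowMagUp (prec : ℕ) (Mr : Array IntervalD) : ℕ → Dyad
  | 0 => Dyad.zero
  | c + 1 => Dyad.addUp prec (rowMagUp prec Mr c) (IntervalD.mag (IntervalD.aget Mr c))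

/-- TEST `‖M‖_∞ ≤ θ`: every upward row sum of magnitudes is `≤ θ`. [folklore] -/
def checkRowSumLe (n prec : ℕ) (M : Array (Array IntervalD)) (θ : Dyad) : Bool :=
  allBelow (fun r => Dyad.ble (rowMagUp prec (rowOf M r) n) θ) n

/-- `max_{r<k} |X r c|` (exact). [folklore] -/
def colMaxAbs (X : Array (Array Dyad)) (c : ℕ) : ℕ → Dyad
  | 0 => Dyad.zero
  | r + 1 => Dyad.max (colMaxAbs X c r) (Dyad.abs (dmget X r c))

/-- One row of `ciBox`. [folklore] -/
def ciBoxRow (n : ℕ) (Xr w : Array Dyad) : Array IntervalD :=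
  Array.ofFn (n := n) fun c => ⟨Dyad.sub (dget Xr c) (dget w c), Dyad.add (dget Xr c) (dget w c)⟩

/-- The box `X ⊕ [−φ·m_c, φ·m_c]` with `m_c = max_{r<n} |X r c|` (the Neumann enclosure of an inverse near `X`). [folklore] -/
def ciBox (n : ℕ) (X : Array (Array Dyad)) (φ : Dyad) : Array (Array IntervalD) :=
  let w : Array Dyad := Array.ofFn (n := n) fun c => Dyad.mul φ (colMaxAbs X c n)
  Array.ofFn (n := n) fun r => ciBoxRow n (rowOf X r) w

variable {n : ℕ} (prec : ℕ)

/-- [folklore] -/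
theorem allBelow_eq_true {p : ℕ → Bool} : ∀ {k : ℕ}, allBelow p k = true ↔ ∀ c < k, p c = true
  | 0 => by simp [allBelow]
  | k + 1 => by
    rw [allBelow, Bool.and_eq_true, allBelow_eq_true]
    constructor
    · rintro ⟨h, hk⟩ c hc
      rcases Nat.lt_succ_iff_lt_or_eq.1 hc with hc | rfl
      exacts [h c hc, hk]
    · exact fun h => ⟨fun c hc => h c (Nat.lt_succ_of_lt hc), h k (Nat.lt_succ_self k)⟩

/-- **Magnitudes bound the members.** [folklore] -/
theorem absLeMat_magM {a : ℕ → ℕ → ℝ} {M : Array (Array IntervalD)} (ha : MemMat n a M) : AbsLeMat n a (magM n M) := by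
  intro r hr c hc
  simp only [magM, dre, dmget_ofFn_row _ c hr, dget_ofFn _ hc]
  exact IntervalD.abs_le_mag (ha r hr c hc)

/-- Entries of `magM` are nonnegative. [folklore] -/
theorem magM_nonneg (M : Array (Array IntervalD)) {r c : ℕ} (hr : r < n) (hc : c < n) : 0 ≤ dre (magM n M) r c := by
  simp only [magM, dre, dmget_ofFn_row _ c hr, dget_ofFn _ hc]
  exact IntervalD.mag_nonneg _

/-- `dre (absD A) r c = |dre A r c|`. [folklore] -/
theorem dre_absD (A : Array (Array Dyad)) {r c : ℕ} (hr : r < n) (hc : c < n) : dre (absD n A) r c = |dre A r c| := by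
  simp only [absD, dre, dmget_ofFn_row _ c hr, dget_ofFn _ hc, Dyad.toReal_abs]
  rfl

/-- `absD A` bounds `A` entrywise in absolute value. [folklore] -/
theorem absLeMat_absD (A : Array (Array Dyad)) : AbsLeMat n (dre A) (absD n A) := fun r hr c hc => by
  rw [dre_absD A hr hc]

/-- A termwise-dominated sum is below the upward dot product. [folklore] -/
theorem sum_le_dotUp (Ar R : Array Dyad) {x : ℕ → ℝ} :
    ∀ k, (∀ t < k, x t ≤ (dget Ar t).toReal * (dget R t).toReal) → ∑ t ∈ Finset.range k, x t ≤ (dotUp prec Ar R k).toReal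
  | 0, _ => by simp [dotUp]
  | k + 1, h => by
    rw [Finset.sum_range_succ, dotUp]
    refine le_trans ?_ (Dyad.add_le_addUp prec _ _)
    exact add_le_add (sum_le_dotUp Ar R k fun t ht => h t (Nat.lt_succ_of_lt ht))
      ((h k (Nat.lt_succ_self k)).trans (Dyad.mul_le_mulUp prec _ _))

/-- **`|Σ_t a r t · ξ t| ≤ (|A|·R)_r`** when `|a| ≤ A` and `|ξ| ≤ R` entrywise. [folklore] -/
theorem abs_sum_le_absMulVecUp {a : ℕ → ℕ → ℝ} {A : Array (Array Dyad)} {ξ : ℕ → ℝ} {R : Array Dyad}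
    (ha : AbsLeMat n a A) (hξ : AbsLeVec n ξ R) {r : ℕ} (hr : r < n) :
    |∑ t ∈ Finset.range n, a r t * ξ t| ≤ vre (absMulVecUp n prec A R) r := by
  simp only [absMulVecUp, vre, dget_ofFn _ hr]
  refine (Finset.abs_sum_le_sum_abs _ _).trans (sum_le_dotUp prec (rowOf A r) R n fun t ht => ?_)
  rw [abs_mul]
  have h1 := ha r hr t ht
  have h2 := hξ t ht
  unfold dre dmget at h1
  unfold vre at h2
  exact mul_le_mul h1 h2 (abs_nonneg _) ((abs_nonneg _).trans h1)

/-- A sum bounded termwise by `A·R` (no absolute values) is below `absMulVecUp`. [folklore] -/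
theorem sum_le_absMulVecUp {A : Array (Array Dyad)} {R : Array Dyad} {x : ℕ → ℕ → ℝ}
    (hx : ∀ r < n, ∀ t < n, x r t ≤ dre A r t * vre R t) {r : ℕ} (hr : r < n) :
    ∑ t ∈ Finset.range n, x r t ≤ vre (absMulVecUp n prec A R) r := by
  simp only [absMulVecUp, vre, dget_ofFn _ hr]
  exact sum_le_dotUp prec (rowOf A r) R n fun t ht => hx r hr t ht

/-- `vre u c + vre v c ≤ vre (addVecUp u v) c`. [folklore] -/
theorem add_le_addVecUp (u v : Array Dyad) {c : ℕ} (hc : c < n) :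
    vre u c + vre v c ≤ vre (addVecUp n prec u v) c := by
  simp only [addVecUp, vre, dget_ofFn _ hc]
  exact Dyad.add_le_addUp prec _ _

/-- `leVec u v` means `vre u c ≤ vre v c` for `c < n`. [folklore] -/
theorem le_of_leVec {u v : Array Dyad} (h : leVec n u v = true) {c : ℕ} (hc : c < n) : vre u c ≤ vre v c :=
  (Dyad.ble_iff _ _).1 ((allBelow_eq_true.1 h) c hc)

/-- `nonnegVec v` means `0 ≤ vre v c` for `c < n`. [folklore] -/
theorem nonneg_of_nonnegVec {v : Array Dyad} (h : nonnegVec n v = true) {c : ℕ} (hc : c < n) : 0 ≤ vre v c := by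
  have := (Dyad.ble_iff _ _).1 ((allBelow_eq_true.1 h) c hc)
  rwa [Dyad.toReal_zero] at this

/-- A termwise-dominated sum of magnitudes is below the upward row sum. [folklore] -/
theorem sum_le_rowMagUp (Mr : Array IntervalD) {x : ℕ → ℝ} :
    ∀ k, (∀ c < k, x c ≤ (IntervalD.mag (IntervalD.aget Mr c)).toReal) →
      ∑ c ∈ Finset.range k, x c ≤ (rowMagUp prec Mr k).toReal
  | 0, _ => by simp [rowMagUp]
  | k + 1, h => by
    rw [Finset.sum_range_succ, rowMagUp]
    refine le_trans ?_ (Dyad.add_le_addUp prec _ _)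
    exact add_le_add (sum_le_rowMagUp Mr k fun c hc => h c (Nat.lt_succ_of_lt hc)) (h k (Nat.lt_succ_self k))

/-- **The row-sum test bounds `‖e‖_∞`**: `Σ_{c<n} |e r c| ≤ θ` for every row `r < n`. [folklore] -/
theorem rowSum_le_of_checkRowSumLe {e : ℕ → ℕ → ℝ} {M : Array (Array IntervalD)} (he : MemMat n e M) {θ : Dyad}
    (h : checkRowSumLe n prec M θ = true) {r : ℕ} (hr : r < n) : ∑ c ∈ Finset.range n, |e r c| ≤ θ.toReal := by
  have hrow := (Dyad.ble_iff _ _).1 ((allBelow_eq_true.1 h) r hr)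
  refine le_trans (sum_le_rowMagUp prec (rowOf M r) n fun c hc => ?_) hrow
  exact IntervalD.abs_le_mag (he r hr c hc)

/-- `0 ≤ colMaxAbs X c k`. [folklore] -/
theorem colMaxAbs_nonneg (X : Array (Array Dyad)) (c : ℕ) : ∀ k, 0 ≤ (colMaxAbs X c k).toReal
  | 0 => by simp [colMaxAbs]
  | k + 1 => by
    rw [colMaxAbs, Dyad.toReal_max]
    exact (colMaxAbs_nonneg X c k).trans (le_max_left _ _)

/-- `|dre X r c| ≤ colMaxAbs X c k` for `r < k`. [folklore] -/
theorem abs_le_colMaxAbs (X : Array (Array Dyad)) (c : ℕ) : ∀ {k r : ℕ}, r < k → |dre X r c| ≤ (colMaxAbs X c k).toReal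
  | 0, _, h => absurd h (Nat.not_lt_zero _)
  | k + 1, r, h => by
    rw [colMaxAbs, Dyad.toReal_max]
    rcases Nat.lt_succ_iff_lt_or_eq.1 h with h | rfl
    · exact (abs_le_colMaxAbs X c h).trans (le_max_left _ _)
    · rw [Dyad.toReal_abs]; exact le_max_right _ _

/-- **Membership in `ciBox`**: a real matrix within `φ·m_c` of `X` in column `c` lies in `ciBox X φ`. [folklore] -/
theorem memMat_ciBox {g : ℕ → ℕ → ℝ} {X : Array (Array Dyad)} {φ : Dyad}
    (hg : ∀ r < n, ∀ c < n, |g r c - dre X r c| ≤ φ.toReal * (colMaxAbs X c n).toReal) : MemMat n g (ciBox n X φ) := by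
  intro r hr c hc
  have hw : (dget (Array.ofFn (n := n) fun c => Dyad.mul φ (colMaxAbs X c n)) c).toReal =
      φ.toReal * (colMaxAbs X c n).toReal := by
    simp only [dget_ofFn _ hc, Dyad.toReal_mul]
  have h := abs_le.1 (hg r hr c hc)
  unfold dre dmget at h
  simp only [ciBox, ciBoxRow, imget_ofFn_row _ c hr, IntervalD.aget_ofFn _ hc]
  refine ⟨?_, ?_⟩
  · simp only [Dyad.toReal_sub, hw]; linarith [h.1]
  · simp only [Dyad.toReal_add, hw]; linarith [h.2]

end Bounds

end Summit.NavierStokesRegularity.NavierStokesRegularity.Theorems.TaylorModelCert
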